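import Literature.MathematicalPhysics.KineticTheory.HarmonicChaosDecomposition
import Literature.MathematicalPhysics.KineticTheory.InfiniteChainGibbsMomentaIndependence
import HarnessLib

/-!
# Stein's identity along one momentum under a DLR state
(helper file 1/2 of stub `stub_harmonicStein` (K1) of line `gram-pencil-harmonic-chaos`, crux
`EmbeddedDrudeMourre.DrudeDissolution`, item stmt-AtomisticToContinuum-12593; `--supports` file,
closes nothing; registered helper theorem `harmonicStein_momentumStein`)

WHAT.
§ Gaussian. For the centred real Gaussian `N(0, v)` (Mathlib `gaussianReal 0 v`):
* `integral_pow_succ_succ_gaussianReal` — the moment recursion `∫ t^{n+2} dN = v (n+1) ∫ t^n dN`;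
* `integral_mul_eval_gaussianReal` — Stein's identity on polynomials, `∫ t · p(t) dN = v ∫ p'(t) dN`;
* `integral_mul_prod_affine_gaussianReal` — the same for a product of affine factors,
  `∫ t ∏ᵢ (aᵢ + cᵢ t) dN = v ∑ᵢ cᵢ ∫ ∏_{j ≠ i} (a_j + c_j t) dN`.

§ MomentumStein. For any nearest-neighbour chain `P` with continuous `U, V`, every `T > 0`, every
DLR state `μ` of `P` at `T` and every site `x`:
* `indepFun_update_snd` — the momentum `p_x` is independent of EVERYTHING ELSE (the configuration
  with `p_x` reset to `0`);
* `map_prod_update_snd` — hence `μ` is the image of `μ ⊗ N(0,T)` under `(η, t) ↦ η[p_x ↦ t]`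
  (resampling `p_x`), and `integral_eq_integral_integral_update_snd` — every `μ`-integral
  disintegrates as `∫ Φ dμ = ∫ (∫ Φ(η[p_x ↦ t]) dN(t)) dμ(η)`;
* `integral_snd_mul_prod_affine` (= `harmonicStein_momentumStein`) — **Stein's identity along `p_x`**
  for a product of observables affine along the `p_x`-line (`gᵢ(σ[p_x ↦ t]) = gᵢ(σ) + cᵢ (t − p_x)`):
  `∫ p_x ∏ᵢ gᵢ dμ = T ∑ᵢ cᵢ ∫ ∏_{j ≠ i} g_j dμ`.

HOW. The moment generating function of `N(0,v)` is `g(s) = exp(v s²/2)` (Mathlib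
`mgf_id_gaussianReal`), its derivatives at `0` are the moments (`iteratedDeriv_mgf_zero`), and
`g' = v·s·g`, so Leibniz' rule (`iteratedDeriv_mul`) gives `g^{(n+2)}(0) = v (n+1) g^{(n)}(0)`;
linearity (`Polynomial.induction_on'`) and `Polynomial.derivative_prod_finset` do the rest.
`IsChainGibbsMeasure.lintegral_snd_mul` (the one-site DLR factorisation of the tree) with
indicator functions gives the independence; Mathlib's `indepFun_iff_map_prod_eq_prod_map_map`
turns it into the product representation; Fubini and the one-dimensional identity finish.
-/

noncomputable section

namespace Summit.AtomisticToContinuum.FouriersLaw.Theorems.DrudeDissolution.GramPencilHarmonicChaos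

open MeasureTheory ProbabilityTheory Function
open Literature.MathematicalPhysics.KineticTheory
open Literature.MathematicalPhysics.KineticTheory.HeatConduction
open scoped NNReal

section Gaussian

open Polynomial

/-- All moments of a real Gaussian are finite. [folklore] -/
theorem integrable_pow_gaussianReal (m : ℝ) (v : ℝ≥0) (n : ℕ) :
    Integrable (fun t : ℝ => t ^ n) (gaussianReal m v) := by
  have h : (0 : ℝ) ∈ interior (integrableExpSet id (gaussianReal m v)) := by simp
  simpa using integrable_pow_of_mem_interior_integrableExpSet h n

/-- Polynomials are integrable against a real Gaussian. [folklore] -/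
theorem integrable_eval_gaussianReal (m : ℝ) (v : ℝ≥0) (p : ℝ[X]) :
    Integrable (fun t : ℝ => p.eval t) (gaussianReal m v) := by
  induction p using Polynomial.induction_on' with
  | add p q hp hq =>
    simp only [eval_add]
    exact hp.add hq
  | monomial n a =>
    simp only [eval_monomial]
    exact (integrable_pow_gaussianReal m v n).const_mul a

/-- The generating function `g(s) = exp(v s²/2)` of the centred Gaussian moments. [folklore] -/
theorem mgf_id_gaussianReal_zero (v : ℝ≥0) :
    mgf id (gaussianReal 0 v) = fun s => Real.exp ((v : ℝ) * s ^ 2 / 2) := by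
  rw [mgf_id_gaussianReal]
  funext s
  simp

/-- `g' = v·s·g` for `g(s) = exp(v s²/2)`. [folklore] -/
theorem deriv_exp_mul_sq_div_two (v : ℝ) :
    deriv (fun s : ℝ => Real.exp (v * s ^ 2 / 2)) = fun s => (v * s) * Real.exp (v * s ^ 2 / 2) := by
  funext s
  have h : HasDerivAt (fun s : ℝ => v * s ^ 2 / 2) (v * s) s := by
    have h1 : HasDerivAt (fun s : ℝ => s ^ 2) (2 * s) s := by simpa using hasDerivAt_pow 2 s
    exact ((h1.const_mul v).div_const 2).congr_deriv (by ring)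
  rw [(h.exp).deriv]
  ring

/-- `g(s) = exp(v s²/2)` is smooth. [folklore] -/
theorem contDiff_exp_mul_sq_div_two (v : ℝ) (n : ℕ∞) :
    ContDiff ℝ n (fun s : ℝ => Real.exp (v * s ^ 2 / 2)) := by
  fun_prop

/-- **Moment recursion of the centred Gaussian**: `∫ t^{n+2} dN(0,v) = v (n+1) ∫ t^n dN(0,v)`.
[folklore] -/
theorem integral_pow_succ_succ_gaussianReal (v : ℝ≥0) (n : ℕ) :
    ∫ t : ℝ, t ^ (n + 2) ∂gaussianReal 0 v = (v : ℝ) * (n + 1) * ∫ t : ℝ, t ^ n ∂gaussianReal 0 v := by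
  have h0 : (0 : ℝ) ∈ interior (integrableExpSet id (gaussianReal 0 v)) := by simp
  have hmom : ∀ k : ℕ, ∫ t : ℝ, t ^ k ∂gaussianReal 0 v =
      iteratedDeriv k (fun s : ℝ => Real.exp ((v : ℝ) * s ^ 2 / 2)) 0 := by
    intro k
    rw [← mgf_id_gaussianReal_zero, iteratedDeriv_mgf_zero h0 k]
    simp
  rw [hmom, hmom, iteratedDeriv_succ', deriv_exp_mul_sq_div_two]
  -- Leibniz for `(v s) · g(s)`
  have hf : ContDiffAt ℝ (↑(n + 1)) (fun s : ℝ => (v : ℝ) * s) 0 := by fun_prop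
  have hg : ContDiffAt ℝ (↑(n + 1)) (fun s : ℝ => Real.exp ((v : ℝ) * s ^ 2 / 2)) 0 :=
    (contDiff_exp_mul_sq_div_two (v : ℝ) _).contDiffAt
  rw [iteratedDeriv_fun_mul hf hg]
  have hid : ∀ i : ℕ, iteratedDeriv i (fun s : ℝ => (v : ℝ) * s) 0 = if i = 1 then (v : ℝ) else 0 := by
    intro i
    rw [iteratedDeriv_const_mul_field]
    have := (iteratedDeriv_fun_id_zero (𝕜 := ℝ) (n := i))
    rw [this]
    split_ifs <;> simp
  simp_rw [hid]
  rw [Finset.sum_eq_single 1]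
  · simp only [if_true, Nat.choose_one_right, Nat.add_sub_cancel]
    push_cast
    ring
  · intro i _ hi
    simp [hi]
  · intro h
    exfalso
    exact h (Finset.mem_range.2 (by omega))

/-- **Stein's identity for the centred Gaussian on polynomials**: `∫ t·p(t) dN(0,v) = v ∫ p'(t) dN(0,v)`.
[folklore] -/
theorem integral_mul_eval_gaussianReal (v : ℝ≥0) (p : ℝ[X]) :
    ∫ t : ℝ, t * p.eval t ∂gaussianReal 0 v = (v : ℝ) * ∫ t : ℝ, (derivative p).eval t ∂gaussianReal 0 v := by
  induction p using Polynomial.induction_on' with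
  | add p q hp hq =>
    simp only [eval_add, derivative_add, mul_add]
    rw [integral_add, integral_add, hp, hq, mul_add]
    · exact integrable_eval_gaussianReal 0 v _
    · exact integrable_eval_gaussianReal 0 v _
    · have h1 := integrable_eval_gaussianReal 0 v (X * p)
      simpa [eval_mul] using h1
    · have h1 := integrable_eval_gaussianReal 0 v (X * q)
      simpa [eval_mul] using h1
  | monomial n a =>
    rw [derivative_monomial]
    simp only [eval_monomial]
    cases n with
    | zero =>
      simp only [pow_zero, mul_one, Nat.cast_zero, mul_zero, zero_mul, integral_zero]
      have h1 : (fun t : ℝ => t * a) = fun t => a * t := funext fun t => mul_comm t a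
      rw [h1, integral_const_mul, integral_id_gaussianReal, mul_zero]
    | succ k =>
      simp only [Nat.add_sub_cancel, Nat.cast_succ]
      have h1 : ∀ t : ℝ, t * (a * t ^ (k + 1)) = a * t ^ (k + 2) := fun t => by ring
      simp_rw [h1]
      rw [integral_const_mul, integral_const_mul, integral_pow_succ_succ_gaussianReal]
      ring

/-- **Stein's identity for a product of affine factors**:
`∫ t ∏_{i ∈ u} (aᵢ + cᵢ t) dN(0,v) = v ∑_{i ∈ u} cᵢ ∫ ∏_{j ∈ u \ {i}} (a_j + c_j t) dN(0,v)`. [folklore] -/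
theorem integral_mul_prod_affine_gaussianReal {ι : Type*} [DecidableEq ι] (v : ℝ≥0) (u : Finset ι)
    (a c : ι → ℝ) :
    ∫ t : ℝ, t * ∏ i ∈ u, (a i + c i * t) ∂gaussianReal 0 v =
      (v : ℝ) * ∑ i ∈ u, c i * ∫ t : ℝ, ∏ j ∈ u.erase i, (a j + c j * t) ∂gaussianReal 0 v := by
  set p : ℝ[X] := ∏ i ∈ u, (C (a i) + C (c i) * X) with hp
  have hev : ∀ t : ℝ, p.eval t = ∏ i ∈ u, (a i + c i * t) := fun t => by
    simp [hp, eval_prod]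
  have hder : derivative p = ∑ i ∈ u, (∏ j ∈ u.erase i, (C (a j) + C (c j) * X)) * C (c i) := by
    rw [hp, derivative_prod_finset]
    refine Finset.sum_congr rfl fun i _ => ?_
    simp
  have h := integral_mul_eval_gaussianReal v p
  simp_rw [hev] at h
  rw [h, hder]
  congr 1
  simp_rw [eval_finsetSum, eval_mul, eval_C, eval_prod]
  rw [integral_finsetSum]
  · refine Finset.sum_congr rfl fun i _ => ?_
    rw [← integral_const_mul]
    refine integral_congr_ae (Filter.Eventually.of_forall fun t => ?_)
    simp only [eval_add, eval_C, eval_mul, eval_X]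
    ring
  · intro i _
    have h1 := integrable_eval_gaussianReal 0 v ((∏ j ∈ u.erase i, (C (a j) + C (c j) * X)) * C (c i))
    refine h1.congr (Filter.Eventually.of_forall fun t => ?_)
    simp [eval_prod]

end Gaussian

section MomentumStein

variable {P : OscillatorChain}

/-- The map `σ ↦ σ[p_x ↦ 0]` (forgetting the momentum at `x`) is measurable. [folklore] -/
theorem measurable_update_snd_zero (x : ℤ) :
    Measurable fun σ : ChainConfig => update σ x ((σ x).1, 0) :=
  measurable_update'.comp (measurable_id.prodMk (((measurable_pi_apply x).fst).prodMk measurable_const))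

/-- The resampling map `(η, t) ↦ η[p_x ↦ t]` is measurable. [folklore] -/
theorem measurable_update_snd (x : ℤ) :
    Measurable fun p : ChainConfig × ℝ => update p.1 x ((p.1 x).1, p.2) := by
  have h1 : Measurable fun p : ChainConfig × ℝ => (p.1 x).1 :=
    ((measurable_pi_apply x).comp measurable_fst).fst
  exact measurable_update'.comp (measurable_fst.prodMk (h1.prodMk measurable_snd))

/-- **Under a DLR state the momentum `p_x` is independent of everything else**: of the
configuration `σ[p_x ↦ 0]`. [cite: LanfordLebowitzLieb1977, §4 remark (ii)] -/
theorem indepFun_update_snd (hU : Continuous P.U) (hV : Continuous P.V) {T : ℝ} (hT : 0 < T)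
    {μ : Measure ChainConfig} (hμ : P.IsChainGibbsMeasure T μ) (x : ℤ) :
    IndepFun (fun σ : ChainConfig => update σ x ((σ x).1, 0)) (fun σ : ChainConfig => (σ x).2) μ := by
  haveI : IsProbabilityMeasure μ := hμ.isProbabilityMeasure
  have hX : Measurable fun σ : ChainConfig => (σ x).2 := (measurable_pi_apply x).snd
  have hY := measurable_update_snd_zero x
  rw [indepFun_iff_measure_inter_preimage_eq_mul]
  intro s t hs ht
  set Y : ChainConfig → ChainConfig := fun σ => update σ x ((σ x).1, 0) with hYdef
  have hG : Measurable fun σ : ChainConfig => s.indicator (1 : ChainConfig → ENNReal) (Y σ) :=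
    (measurable_one.indicator hs).comp hY
  have hGi : ∀ (σ : ChainConfig) (p : ℝ),
      s.indicator (1 : ChainConfig → ENNReal) (Y (update σ x ((σ x).1, p))) =
        s.indicator (1 : ChainConfig → ENNReal) (Y σ) := by
    intro σ p
    have : Y (update σ x ((σ x).1, p)) = Y σ := by
      simp [hYdef, update_idem]
    rw [this]
  have key := hμ.lintegral_snd_mul hU hV hT x (measurable_one.indicator ht) hG hGi
  have hN : ∫⁻ p, t.indicator (1 : ℝ → ENNReal) p ∂gaussianReal 0 T.toNNReal =
      μ ((fun σ : ChainConfig => (σ x).2) ⁻¹' t) := by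
    rw [lintegral_indicator_one ht, ← hμ.map_snd hU hV hT x, Measure.map_apply hX ht]
  have hR : ∫⁻ σ, s.indicator (1 : ChainConfig → ENNReal) (Y σ) ∂μ = μ (Y ⁻¹' s) := by
    rw [← lintegral_indicator_one (hs.preimage hY)]
    refine lintegral_congr fun σ => ?_
    by_cases h : Y σ ∈ s <;> simp [h, Set.indicator]
  have hL : ∫⁻ σ, t.indicator (1 : ℝ → ENNReal) (σ x).2 * s.indicator (1 : ChainConfig → ENNReal) (Y σ) ∂μ =
      μ (Y ⁻¹' s ∩ (fun σ : ChainConfig => (σ x).2) ⁻¹' t) := by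
    rw [← lintegral_indicator_one ((hs.preimage hY).inter (ht.preimage hX))]
    refine lintegral_congr fun σ => ?_
    by_cases h1 : (σ x).2 ∈ t <;> by_cases h2 : Y σ ∈ s <;> simp [h1, h2, Set.indicator]
  rw [hN, hR, hL] at key
  rw [key, mul_comm]

/-- **Resampling one momentum**: a DLR state `μ` at temperature `T` is the image of
`μ ⊗ N(0,T)` under `(η, t) ↦ η[p_x ↦ t]`. [cite: LanfordLebowitzLieb1977, §4 remark (ii)] -/
theorem map_prod_update_snd (hU : Continuous P.U) (hV : Continuous P.V) {T : ℝ} (hT : 0 < T)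
    {μ : Measure ChainConfig} (hμ : P.IsChainGibbsMeasure T μ) (x : ℤ) :
    (μ.prod (gaussianReal 0 T.toNNReal)).map (fun p : ChainConfig × ℝ => update p.1 x ((p.1 x).1, p.2)) = μ := by
  haveI : IsProbabilityMeasure μ := hμ.isProbabilityMeasure
  have hX : Measurable fun σ : ChainConfig => (σ x).2 := (measurable_pi_apply x).snd
  have hY := measurable_update_snd_zero x
  have hins := measurable_update_snd x
  set X : ChainConfig → ℝ := fun σ => (σ x).2 with hXdef
  set Y : ChainConfig → ChainConfig := fun σ => update σ x ((σ x).1, 0) with hYdef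
  set ins : ChainConfig × ℝ → ChainConfig := fun p => update p.1 x ((p.1 x).1, p.2) with hinsdef
  have h1 : μ.map (fun σ => (Y σ, X σ)) = (μ.map Y).prod (μ.map X) :=
    (indepFun_iff_map_prod_eq_prod_map_map hY.aemeasurable hX.aemeasurable).1
      (indepFun_update_snd hU hV hT hμ x)
  have h2 : ins ∘ (fun σ => (Y σ, X σ)) = id := by
    funext σ
    simp [hinsdef, hYdef, hXdef, update_idem]
  have h3 : ins ∘ (Prod.map Y id) = ins := by
    funext p
    simp [hinsdef, hYdef, update_idem]
  calc (μ.prod (gaussianReal 0 T.toNNReal)).map ins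
      = ((μ.prod (gaussianReal 0 T.toNNReal)).map (Prod.map Y id)).map ins := by
        rw [Measure.map_map hins (hY.prodMap measurable_id), h3]
    _ = ((μ.map Y).prod ((gaussianReal 0 T.toNNReal).map id)).map ins := by
        rw [Measure.map_prod_map _ _ hY measurable_id]
    _ = ((μ.map Y).prod (μ.map X)).map ins := by rw [Measure.map_id, hμ.map_snd hU hV hT x]
    _ = (μ.map (fun σ => (Y σ, X σ))).map ins := by rw [h1]
    _ = μ.map (ins ∘ fun σ => (Y σ, X σ)) := Measure.map_map hins (hY.prodMk hX)
    _ = μ := by rw [h2, Measure.map_id]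

/-- **Disintegration along one momentum**: for every `μ`-integrable `Φ`,
`∫ Φ dμ = ∫ (∫ Φ(η[p_x ↦ t]) dN(0,T)(t)) dμ(η)`, and `(η, t) ↦ Φ(η[p_x ↦ t])` is
`μ ⊗ N(0,T)`-integrable. [cite: LanfordLebowitzLieb1977, §4 remark (ii)] -/
theorem integral_eq_integral_integral_update_snd (hU : Continuous P.U) (hV : Continuous P.V)
    {T : ℝ} (hT : 0 < T) {μ : Measure ChainConfig} (hμ : P.IsChainGibbsMeasure T μ) (x : ℤ)
    {Φ : ChainConfig → ℝ} (hΦ : Integrable Φ μ) :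
    (∫ σ, Φ σ ∂μ = ∫ η, ∫ t, Φ (update η x ((η x).1, t)) ∂gaussianReal 0 T.toNNReal ∂μ) ∧
      Integrable (fun p : ChainConfig × ℝ => Φ (update p.1 x ((p.1 x).1, p.2)))
        (μ.prod (gaussianReal 0 T.toNNReal)) := by
  haveI : IsProbabilityMeasure μ := hμ.isProbabilityMeasure
  have hrep := map_prod_update_snd hU hV hT hμ x
  have hins := measurable_update_snd x
  have hae : AEStronglyMeasurable Φ ((μ.prod (gaussianReal 0 T.toNNReal)).map
      (fun p : ChainConfig × ℝ => update p.1 x ((p.1 x).1, p.2))) := by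
    rw [hrep]; exact hΦ.aestronglyMeasurable
  have hI : Integrable (fun p : ChainConfig × ℝ => Φ (update p.1 x ((p.1 x).1, p.2)))
      (μ.prod (gaussianReal 0 T.toNNReal)) := by
    have h := (integrable_map_measure hae hins.aemeasurable).1 (by rw [hrep]; exact hΦ)
    exact h
  refine ⟨?_, hI⟩
  calc ∫ σ, Φ σ ∂μ
      = ∫ σ, Φ σ ∂((μ.prod (gaussianReal 0 T.toNNReal)).map
          (fun p : ChainConfig × ℝ => update p.1 x ((p.1 x).1, p.2))) := by rw [hrep]
    _ = ∫ p, Φ (update p.1 x ((p.1 x).1, p.2)) ∂(μ.prod (gaussianReal 0 T.toNNReal)) :=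
          integral_map hins.aemeasurable hae
    _ = ∫ η, ∫ t, Φ (update η x ((η x).1, t)) ∂gaussianReal 0 T.toNNReal ∂μ := integral_prod _ hI

/-- **Stein's identity along one momentum under a DLR state.** For observables `gᵢ`, `i ∈ u`,
affine along the `p_x`-line with slopes `cᵢ` (`gᵢ(σ[p_x ↦ t]) = gᵢ(σ) + cᵢ (t − p_x(σ))`), and the
evident integrability: `∫ p_x ∏ᵢ gᵢ dμ = T ∑ᵢ cᵢ ∫ ∏_{j ≠ i} g_j dμ` (Gaussian integration by parts
in `p_x`, conditionally on everything else). [cite: LanfordLebowitzLieb1977, §4 remark (ii)] -/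
theorem integral_snd_mul_prod_affine (hU : Continuous P.U) (hV : Continuous P.V) {T : ℝ}
    (hT : 0 < T) {μ : Measure ChainConfig} (hμ : P.IsChainGibbsMeasure T μ) (x : ℤ)
    {ι : Type*} [DecidableEq ι] (u : Finset ι) (g : ι → ChainConfig → ℝ) (c : ι → ℝ)
    (haff : ∀ i ∈ u, ∀ (σ : ChainConfig) (t : ℝ),
      g i (update σ x ((σ x).1, t)) = g i σ + c i * (t - (σ x).2))
    (hint : Integrable (fun σ => (σ x).2 * ∏ i ∈ u, g i σ) μ)
    (hint' : ∀ i ∈ u, Integrable (fun σ => ∏ j ∈ u.erase i, g j σ) μ) :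
    ∫ σ, (σ x).2 * ∏ i ∈ u, g i σ ∂μ = T * ∑ i ∈ u, c i * ∫ σ, ∏ j ∈ u.erase i, g j σ ∂μ := by
  haveI : IsProbabilityMeasure μ := hμ.isProbabilityMeasure
  set N : Measure ℝ := gaussianReal 0 T.toNNReal with hNdef
  have hTv : ((T.toNNReal : ℝ≥0) : ℝ) = T := Real.coe_toNNReal T hT.le
  -- the product along the resampled line
  set a : ι → ChainConfig → ℝ := fun i η => g i η - c i * (η x).2 with ha
  have e0 : ∀ (v : Finset ι), v ⊆ u → ∀ (η : ChainConfig) (t : ℝ),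
      ∏ j ∈ v, g j (update η x ((η x).1, t)) = ∏ j ∈ v, (a j η + c j * t) := by
    intro v hv η t
    refine Finset.prod_congr rfl fun j hj => ?_
    rw [haff j (hv hj) η t, ha]
    ring
  obtain ⟨h1, -⟩ := integral_eq_integral_integral_update_snd hU hV hT hμ x hint
  have h2 := fun i (hi : i ∈ u) => integral_eq_integral_integral_update_snd hU hV hT hμ x (hint' i hi)
  rw [h1]
  have inner : ∀ η : ChainConfig,
      ∫ t, (update η x ((η x).1, t) x).2 * ∏ i ∈ u, g i (update η x ((η x).1, t)) ∂N =
        T * ∑ i ∈ u, c i * ∫ t, ∏ j ∈ u.erase i, g j (update η x ((η x).1, t)) ∂N := by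
    intro η
    simp_rw [update_self, e0 u subset_rfl η]
    rw [hNdef, integral_mul_prod_affine_gaussianReal, hTv]
    congr 1
    refine Finset.sum_congr rfl fun i _ => ?_
    simp_rw [e0 (u.erase i) (Finset.erase_subset i u) η]
  refine (integral_congr_ae (Filter.Eventually.of_forall inner)).trans ?_
  rw [integral_const_mul, integral_finsetSum]
  · congr 1
    refine Finset.sum_congr rfl fun i hi => ?_
    rw [integral_const_mul, (h2 i hi).1]
  · intro i hi
    exact ((h2 i hi).2.integral_prod_left).const_mul (c i)

end MomentumStein

/-! ## The registered helper theorem -/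

/-- **Registered helper theorem of stub K1 (`stub_harmonicStein`): Stein's identity along one
momentum under a DLR state.** For any nearest-neighbour chain `P` with continuous `U, V`, every
`T > 0`, every DLR state `μ` of `P` at `T`, every site `x` and observables `gᵢ`, `i ∈ u`, affine
along the `p_x`-line with slopes `cᵢ`: `∫ p_x ∏ᵢ gᵢ dμ = T ∑ᵢ cᵢ ∫ ∏_{j ≠ i} g_j dμ`.
[cite: LanfordLebowitzLieb1977, §4 remark (ii)] -/
theorem harmonicStein_momentumStein :
    ∀ (P : OscillatorChain), Continuous P.U → Continuous P.V → ∀ (T : ℝ), 0 < T →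
      ∀ (μ : MeasureTheory.Measure ChainConfig), P.IsChainGibbsMeasure T μ → ∀ (x : ℤ) {ι : Type}
        [DecidableEq ι] (u : Finset ι) (g : ι → ChainConfig → ℝ) (c : ι → ℝ),
        (∀ i ∈ u, ∀ (σ : ChainConfig) (t : ℝ),
          g i (Function.update σ x ((σ x).1, t)) = g i σ + c i * (t - (σ x).2)) →
        MeasureTheory.Integrable (fun σ : ChainConfig => (σ x).2 * ∏ i ∈ u, g i σ) μ →
        (∀ i ∈ u, MeasureTheory.Integrable (fun σ : ChainConfig => ∏ j ∈ u.erase i, g j σ) μ) →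
        ∫ σ, (σ x).2 * ∏ i ∈ u, g i σ ∂μ = T * ∑ i ∈ u, c i * ∫ σ, ∏ j ∈ u.erase i, g j σ ∂μ :=
  fun _ hU hV _ hT _ hμ x _ _ u g c haff hint hint' =>
    integral_snd_mul_prod_affine hU hV hT hμ x u g c haff hint hint'

end Summit.AtomisticToContinuum.FouriersLaw.Theorems.DrudeDissolution.GramPencilHarmonicChaos

end
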